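import Summits.NavierStokesRegularity.NavierStokesRegularity.Theorems.ScenarioCensusRowF19obSchema

/-!
# Census row F19 family, member F19ob «observer tops» — part 3/4: SIGNED rows (subcritical speed GAIN along
# an observer): P-obs ⊋ F-obs, P-lab, P-pow, the gain floor

Re-homed for the scenario census (typer seat ns-census-typer-2 g8; lead g7 GO 2026-08-28T17:18Z: PORT of ns-idea-3 LINE 12
«observer-top» REV 2, `pub/ideators/ns-idea-3/lines/observer-top/line-observer-top.lean`, sha16 d9972826d387f45a, 924 l.,
lean check rc 0, 0 sorry; ref g7 PRE-CHECK ✓ §12.24; critic idea-crit-3 RE-STAMP CONFORMS 16:39:31Z; booked as TREE records of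
F19 family MEMBERS under ROW POLICY 15:11Z / cen9 (2), no new row), split for the 400-line rule into
`ScenarioCensusRowF19obTop` (§1–§3: instrument, rows, tools, calculus along characteristics) → `ScenarioCensusRowF19obSchema`
(§4–§5: the schema row F-obs from row F1a BY NAME, instances, structural theorems, residual) → `ScenarioCensusRowF19obSigned`
(§6: signed rows) → `ScenarioCensusRowF19ob` (census keys).  Lean text VERBATIM in namespace `…Theorems.ScenarioCensus.ObserverTop`
(the line's `…Cruxes.ScenarioCensusRowF1.ObserverTopLine` re-homed); the four real-variable tools identical to LINE 11's
(`deltaStar_pos`, `kappa_mul_lt_one`, `hasDerivAt_inv_sqrt_sub`, `norm_le_barrier`) are taken from the tree's F19 port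
(`ScenarioCensus.QuasiSteadyTop`, `ScenarioCensusRowF19Top.lean`) instead of being restated; one bib key corrected
(`Tao2013Localisation`); the `[folklore]` tags of the parameterless row `def`s dropped (gate relocation rule), as in the F19 port.

§6 of the line: only speed GAIN is fenced — `HasSubcriticalGainAlong ν T δ b u` := `⟪u, D^b u⟫ ≤ δ√ν(T−t)^{-3/2}|u|` at fast
points (`= ½ d/ds|u(s,X(s))|²`; speed LOSS free).  Schema row `Row_Pobs` ⊋ F-obs (`rowPobs_holds` via `rowPobs_of_rowF1a`;
`rowFobs_of_rowPobs` by Cauchy–Schwarz); instances `Row_Plab` (`⟪u, ∂ₜu⟫ ≤ δ√ν(T−t)^{-3/2}|u|`) and `Row_Ppow` (the POWER of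
the net force on fast particles); structural `GainFloor` / `gainFloor_holds`, `forceFloor_of_gainFloor`; scalar fencing lemma
`norm_le_barrier_signed`.

No census value is asserted here; NS regularity is NOT proved; no summit statement is proved by this file.
-/

noncomputable section

set_option linter.dupNamespace false

open MeasureTheory Set Function Filter TopologicalSpace Metric
open scoped Topology NNReal ENNReal Laplacian RealInnerProductSpace

namespace Summit.NavierStokesRegularity.NavierStokesRegularity.Theorems.ScenarioCensus.ObserverTop

open Literature.Analysis Literature.Analysis.FluidPDE
open Summit.NavierStokesRegularity.NavierStokesRegularity.Theorems

/-! ## §6 SIGNED rows: subcritical speed GAIN along an observer (one-sided, scalar sharpening)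

The fencing only ever needs an upper bound on the GROWTH of the speed along the characteristic.
`⟪u, D^b u⟫ = ½ d/ds |u(s,X(s))|²`, so the one-sided scalar criterion
`⟪u, D^b u⟫ ≤ δ√ν(T−t)^{-3/2}|u|` at fast points (speed LOSS unrestricted) already excludes blow-up.
For the Lagrangian observer `⟪u, Dₜu⟫ = ⟪u, νΔu − ∇p⟫` is the POWER of the net force on the particle:
«no blow-up without supercritical work on the fast fluid» (`gainFloor_holds`). -/

/-- **Subcritical speed gain along the observer `b`, modulus `δ`** (signed, scalar): at fast points
near `T`, `⟪u, ∂ₜu + (b·∇)u⟫ ≤ δ√ν/((T−t)√(T−t)) · |u|`. [folklore] -/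
def HasSubcriticalGainAlong (ν T δ : ℝ) (b u : ℝ → E3 → E3) : Prop :=
  ∃ Λ : ℝ, ∀ᶠ t in 𝓝[<] T, ∀ x, Λ < ‖u t x‖ →
    ⟪u t x, timeDerivWithin (Ico 0 T) u t x + convect (b t) (u t) x⟫ ≤
      δ * Real.sqrt ν / ((T - t) * Real.sqrt (T - t)) * ‖u t x‖

/-- **Signed schema row P-obs**: Clay frame (no rate) + observer admissible from every interior time +
subcritical speed gain along it with modulus `0 ≤ δ < 9 − 2√15` ⇒ extension.  PROVED
(`rowPobs_holds`); it implies `Row_Fobs` (`rowFobs_of_rowPobs`, Cauchy–Schwarz). -/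
def Row_Pobs : Prop :=
  ∀ (ν T δ : ℝ), 0 < ν → 0 < T → 0 ≤ δ → δ < 9 - 2 * Real.sqrt 15 →
    ∀ (b u : ℝ → E3 → E3) (p : ℝ → E3 → ℝ),
    IsClassicalNSSolutionOn (Ico 0 T) ν 0 u p → IsLerayHopfOn T ν 0 (u 0) u →
    HasRapidSpatialDecay (u 0) → (∀ t₁ ∈ Ioo 0 T, HasCharacteristics b t₁ T) →
    HasSubcriticalGainAlong ν T δ b u → HasSmoothExtensionPast ν 0 u T

/-- **Row P-lab** («slow-gain top», lab observer): `∂ₜ|u| ≤ δ√ν(T−t)^{-3/2}` at fast points, in the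
form `⟪u, ∂ₜu⟫ ≤ δ√ν(T−t)^{-3/2}|u|`, `0 ≤ δ < 9 − 2√15` ⇒ extension (one-sided sharpening of LINE 11's
F-qs).  PROVED (`rowPlab_holds`). -/
def Row_Plab : Prop :=
  ∀ (ν T δ : ℝ), 0 < ν → 0 < T → 0 ≤ δ → δ < 9 - 2 * Real.sqrt 15 →
    ∀ (u : ℝ → E3 → E3) (p : ℝ → E3 → ℝ),
    IsClassicalNSSolutionOn (Ico 0 T) ν 0 u p → IsLerayHopfOn T ν 0 (u 0) u →
    HasRapidSpatialDecay (u 0) →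
    (∃ Λ : ℝ, ∀ᶠ t in 𝓝[<] T, ∀ x, Λ < ‖u t x‖ →
      ⟪u t x, timeDerivWithin (Ico 0 T) u t x⟫ ≤
        δ * Real.sqrt ν / ((T - t) * Real.sqrt (T - t)) * ‖u t x‖) →
    HasSmoothExtensionPast ν 0 u T

/-- **Row P-pow** («subcritical power top», Lagrangian observer through the momentum equation): the
POWER of the net force on fast particles is subcritical, `⟪u, νΔu − ∇p⟫ ≤ δ√ν(T−t)^{-3/2}|u|`,
`0 ≤ δ < 9 − 2√15` ⇒ extension.  PROVED (`rowPpow_holds`). -/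
def Row_Ppow : Prop :=
  ∀ (ν T δ : ℝ), 0 < ν → 0 < T → 0 ≤ δ → δ < 9 - 2 * Real.sqrt 15 →
    ∀ (u : ℝ → E3 → E3) (p : ℝ → E3 → ℝ),
    IsClassicalNSSolutionOn (Ico 0 T) ν 0 u p → IsLerayHopfOn T ν 0 (u 0) u →
    HasRapidSpatialDecay (u 0) →
    (∃ Λ : ℝ, ∀ᶠ t in 𝓝[<] T, ∀ x, Λ < ‖u t x‖ →
      ⟪u t x, ν • Δ (u t) x - gradient (p t) x⟫ ≤
        δ * Real.sqrt ν / ((T - t) * Real.sqrt (T - t)) * ‖u t x‖) →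
    HasSmoothExtensionPast ν 0 u T

/-- **Structural statement «the gain floor / no blow-up without work»**: at fast particles of every
Clay blow-up (any rate) the power of the net force exceeds `δ√ν(T−t)^{-3/2}|u|` — the speed of some fast
particle is INCREASING at a supercritical rate — arbitrarily close to `T`, above every speed level, for
every `δ < 9 − 2√15`.  PROVED (`gainFloor_holds`). -/
def GainFloor : Prop :=
  ∀ (ν T : ℝ), 0 < ν → 0 < T →
    ∀ (u : ℝ → E3 → E3) (p : ℝ → E3 → ℝ),
    IsMaximalSmoothSolution ν 0 u p T → IsLerayHopfOn T ν 0 (u 0) u → HasRapidSpatialDecay (u 0) →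
    ∀ (δ Λ t₁ : ℝ), 0 ≤ δ → δ < 9 - 2 * Real.sqrt 15 → t₁ < T →
      ∃ t ∈ Ioo t₁ T, ∃ x, Λ < ‖u t x‖ ∧
        δ * Real.sqrt ν / ((T - t) * Real.sqrt (T - t)) * ‖u t x‖ <
          ⟪u t x, ν • Δ (u t) x - gradient (p t) x⟫

/-- **The signed fencing step** (scalar): as `QuasiSteadyTop.norm_le_barrier`, but only the radial component
`⟪f, f′⟫ < δc/((T−s)√(T−s)) · ‖f‖` at fast points is assumed; proof via `‖f‖²` and Mathlib's
`image_le_of_deriv_right_lt_deriv_boundary'`. [folklore] -/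
theorem norm_le_barrier_signed {F : Type*} [NormedAddCommGroup F] [InnerProductSpace ℝ F]
    {f : ℝ → F} {f' : ℝ → F} {a b T Λ K δc : ℝ} (hbT : b < T) (hδc : 0 ≤ δc) (hΛK : Λ < K) (hK : 0 < K)
    (hf : ContinuousOn f (Icc a b)) (hf' : ∀ s ∈ Ico a b, HasDerivWithinAt f (f' s) (Ici s) s)
    (hfast : ∀ s ∈ Ico a b, Λ < ‖f s‖ → 0 < ‖f s‖ →
      ⟪f s, f' s⟫ < δc / ((T - s) * Real.sqrt (T - s)) * ‖f s‖)
    (ha : ‖f a‖ ≤ K) :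
    ∀ s ∈ Icc a b, ‖f s‖ ≤ K + 2 * δc * ((Real.sqrt (T - s))⁻¹ - (Real.sqrt (T - a))⁻¹) := by
  intro s hs
  by_cases hab : a ≤ b
  swap
  · exact absurd (hs.1.trans hs.2) hab
  set B : ℝ → ℝ := fun s => K + 2 * δc * ((Real.sqrt (T - s))⁻¹ - (Real.sqrt (T - a))⁻¹) with hB
  set B' : ℝ → ℝ := fun s => 2 * δc * (1 / (2 * ((T - s) * Real.sqrt (T - s)))) with hB'
  have hBd : ∀ s, s < T → HasDerivAt B (B' s) s := by
    intro s hsT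
    have h := ((QuasiSteadyTop.hasDerivAt_inv_sqrt_sub hsT).sub_const ((Real.sqrt (T - a))⁻¹)).const_mul (2 * δc)
    simpa [hB, hB'] using h.const_add K
  have hBK : ∀ s ∈ Icc a b, K ≤ B s := by
    intro s hs'
    have hTs : 0 < T - s := by linarith [hs'.2]
    have hmono : Real.sqrt (T - s) ≤ Real.sqrt (T - a) := Real.sqrt_le_sqrt (by linarith [hs'.1])
    have hinv : (Real.sqrt (T - a))⁻¹ ≤ (Real.sqrt (T - s))⁻¹ :=
      inv_anti₀ (Real.sqrt_pos.2 hTs) hmono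
    have : 0 ≤ 2 * δc * ((Real.sqrt (T - s))⁻¹ - (Real.sqrt (T - a))⁻¹) :=
      mul_nonneg (by positivity) (sub_nonneg.2 hinv)
    simp only [hB]; linarith
  have hBpos : ∀ s ∈ Icc a b, 0 < B s := fun s hs' => hK.trans_le (hBK s hs')
  -- fence g = ‖f‖² under B²
  set g : ℝ → ℝ := fun s => ‖f s‖ ^ 2 with hg
  have hgc : ContinuousOn g (Icc a b) := (continuous_norm.comp_continuousOn hf).pow 2
  have hgd : ∀ s ∈ Ico a b, HasDerivWithinAt g (2 * ⟪f s, f' s⟫) (Ici s) s := fun s hs' =>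
    (hf' s hs').norm_sq
  have hB2c : ContinuousOn (fun s => B s ^ 2) (Icc a b) := fun s hs' =>
    ((hBd s (lt_of_le_of_lt hs'.2 hbT)).continuousAt.pow 2).continuousWithinAt
  have hB2d : ∀ s ∈ Ico a b, HasDerivWithinAt (fun s => B s ^ 2) (2 * B s * B' s) (Ici s) s := by
    intro s hs'
    have h := (hBd s (hs'.2.trans hbT)).hasDerivWithinAt (s := Ici s)
    refine (h.pow 2).congr_deriv ?_
    push_cast
    ring
  have hga : g a ≤ B a ^ 2 := by
    have hBa : ‖f a‖ ≤ B a := by simpa [hB] using ha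
    simp only [hg]
    exact pow_le_pow_left₀ (norm_nonneg _) hBa 2
  have hbound : ∀ s ∈ Ico a b, g s = B s ^ 2 → 2 * ⟪f s, f' s⟫ < 2 * B s * B' s := by
    intro s hs' hEq
    have hsI : s ∈ Icc a b := ⟨hs'.1, hs'.2.le⟩
    have hnorm : ‖f s‖ = B s := by
      have h1 : ‖f s‖ ^ 2 = B s ^ 2 := by simpa [hg] using hEq
      exact (pow_left_inj₀ (norm_nonneg _) (hBpos s hsI).le two_ne_zero).1 h1
    have hfastK : Λ < ‖f s‖ := by rw [hnorm]; exact lt_of_lt_of_le hΛK (hBK s hsI)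
    have hpos : 0 < ‖f s‖ := by rw [hnorm]; exact hBpos s hsI
    have h := hfast s hs' hfastK hpos
    have hTs : 0 < T - s := by linarith [hs'.2]
    have hB's : B' s = δc / ((T - s) * Real.sqrt (T - s)) := by
      simp only [hB']; field_simp
    rw [hB's, ← hnorm]
    nlinarith [h, hpos]
  have hle := image_le_of_deriv_right_lt_deriv_boundary' hgc hgd hga hB2c hB2d hbound hs
  have hsq : ‖f s‖ ^ 2 ≤ B s ^ 2 := by simpa [hg] using hle
  show ‖f s‖ ≤ B s
  exact (pow_le_pow_iff_left₀ (norm_nonneg _) (hBpos s hs).le two_ne_zero).1 hsq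

/-- **Signed fencing along characteristics.** [folklore] -/
theorem norm_le_of_subcriticalGainAlong {ν T t₁ Λ M δc : ℝ} {b u : ℝ → E3 → E3} {p : ℝ → E3 → ℝ}
    (hsol : IsClassicalNSSolutionOn (Ico 0 T) ν 0 u p) (ht₁ : 0 < t₁) (hδc : 0 ≤ δc)
    (hM : ∀ x, ‖u t₁ x‖ ≤ M) (hchar : HasCharacteristics b t₁ T)
    (hqs : ∀ s ∈ Ico t₁ T, ∀ x, Λ < ‖u s x‖ → 0 < ‖u s x‖ →
      ⟪u s x, timeDerivWithin (Ico 0 T) u s x + convect (b s) (u s) x⟫ <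
        δc / ((T - s) * Real.sqrt (T - s)) * ‖u s x‖) :
    ∀ t ∈ Ioo t₁ T, ∀ x,
      ‖u t x‖ ≤ (M + max Λ 0 + 1) + 2 * δc * ((Real.sqrt (T - t))⁻¹ - (Real.sqrt (T - t₁))⁻¹) := by
  intro t ht x
  obtain ⟨X, hXt, hXc, hXd⟩ := hchar t ht x
  have hM0 : 0 ≤ M := (norm_nonneg _).trans (hM (X t₁))
  have hK : Λ < M + max Λ 0 + 1 := by linarith [le_max_left Λ 0]
  have hK0 : 0 < M + max Λ 0 + 1 := by linarith [le_max_right Λ 0]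
  have hcont : ContinuousOn (fun s => u s (X s)) (Icc t₁ t) := by
    have hc := hsol.smooth_velocity.continuousOn
    have hmaps : MapsTo (fun s : ℝ => ((s, X s) : ℝ × E3)) (Icc t₁ t) (Ico 0 T ×ˢ (univ : Set E3)) :=
      fun s hs => ⟨⟨ht₁.le.trans hs.1, lt_of_le_of_lt hs.2 ht.2⟩, mem_univ _⟩
    exact hc.comp (continuousOn_id.prodMk hXc) hmaps
  have hder : ∀ s ∈ Ico t₁ t, HasDerivWithinAt (fun r => u r (X r))
      (timeDerivWithin (Ico 0 T) u s (X s) + convect (b s) (u s) (X s)) (Ici s) s := by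
    intro s hs
    exact hasDerivWithinAt_along hsol ⟨ht₁.trans_le hs.1, hs.2.trans ht.2⟩ (hXd s hs)
  have hfast : ∀ s ∈ Ico t₁ t, Λ < ‖u s (X s)‖ → 0 < ‖u s (X s)‖ →
      ⟪u s (X s), timeDerivWithin (Ico 0 T) u s (X s) + convect (b s) (u s) (X s)⟫ <
        δc / ((T - s) * Real.sqrt (T - s)) * ‖u s (X s)‖ := fun s hs hΛ h0 =>
    hqs s ⟨hs.1, hs.2.trans ht.2⟩ (X s) hΛ h0
  have h := norm_le_barrier_signed ht.2 hδc hK hK0 hcont hder hfast ((hM (X t₁)).trans (by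
    linarith [le_max_right Λ 0])) t ⟨ht.1.le, le_rfl⟩
  simpa [hXt] using h

/-- **Signed schema row P-obs from row F1a** (BY NAME). [folklore] -/
theorem rowPobs_of_rowF1a (hF1a : ScenarioCensus.Row_F1a) : Row_Pobs := by
  intro ν T δ hν hT hδ hδlt b u p hsol hLH hdec hchar hqs
  obtain ⟨Λ, hev⟩ := hqs
  obtain ⟨T₀, hT₀T, hT₀⟩ := mem_nhdsLT_iff_exists_Ioo_subset.1 hev
  set t₁ : ℝ := (max T₀ 0 + T) / 2 with ht₁def
  have ht₁0 : 0 < t₁ := by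
    have : 0 ≤ max T₀ 0 := le_max_right _ _
    rw [ht₁def]; linarith
  have ht₁T : t₁ < T := by
    have : max T₀ 0 < T := max_lt hT₀T hT
    rw [ht₁def]; linarith
  have hT₀t₁ : T₀ < t₁ := by
    have h1 : T₀ ≤ max T₀ 0 := le_max_left _ _
    have h2 : max T₀ 0 < T := max_lt hT₀T hT
    rw [ht₁def]; linarith
  obtain ⟨M, hM0, hM⟩ := exists_sup_bound_at hν hT hsol hLH hdec ⟨ht₁0, ht₁T⟩
  set g : ℝ := 9 - 2 * Real.sqrt 15 - δ with hgdef
  have hg : 0 < g := by rw [hgdef]; linarith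
  have hsν : 0 < Real.sqrt ν := Real.sqrt_pos.2 hν
  set δc : ℝ := (δ + g / 4) * Real.sqrt ν with hδcdef
  have hδc : 0 ≤ δc := by rw [hδcdef]; positivity
  have hqs' : ∀ s ∈ Ico t₁ T, ∀ x, Λ < ‖u s x‖ → 0 < ‖u s x‖ →
      ⟪u s x, timeDerivWithin (Ico 0 T) u s x + convect (b s) (u s) x⟫ <
        δc / ((T - s) * Real.sqrt (T - s)) * ‖u s x‖ := by
    intro s hs x hΛ h0
    have hsT : 0 < T - s := sub_pos.2 hs.2
    have hden : 0 < (T - s) * Real.sqrt (T - s) := mul_pos hsT (Real.sqrt_pos.2 hsT)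
    have h := hT₀ ⟨hT₀t₁.trans_le hs.1, hs.2⟩ x hΛ
    refine lt_of_le_of_lt h (mul_lt_mul_of_pos_right (div_lt_div_of_pos_right ?_ hden) h0)
    rw [hδcdef]
    have : δ < δ + g / 4 := by linarith
    exact mul_lt_mul_of_pos_right this hsν
  have hbound := norm_le_of_subcriticalGainAlong hsol ht₁0 hδc hM (hchar t₁ ⟨ht₁0, ht₁T⟩) hqs'
  set K : ℝ := M + max Λ 0 + 1 with hKdef
  have hK0 : 0 < K := by
    have : 0 ≤ max Λ 0 := le_max_right _ _
    rw [hKdef]; linarith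
  set C : ℝ := δ + 9 - 2 * Real.sqrt 15 with hCdef
  have hC0 : 0 < C := by rw [hCdef]; linarith [QuasiSteadyTop.deltaStar_pos]
  have hκC : (9 + 2 * Real.sqrt 15) / 42 * C < 1 := by rw [hCdef]; exact QuasiSteadyTop.kappa_mul_lt_one hδlt
  set ρ : ℝ := (g * Real.sqrt ν / (2 * K)) ^ 2 with hρdef
  have hρ : 0 < ρ := by rw [hρdef]; positivity
  set t₂ : ℝ := max t₁ (T - ρ) with ht₂def
  have ht₂T : t₂ < T := max_lt ht₁T (by linarith)
  have hrate : ∀ᶠ t in 𝓝[<] T, ∀ x, Real.sqrt (T - t) * ‖u t x‖ ≤ C * Real.sqrt ν := by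
    filter_upwards [Ioo_mem_nhdsLT ht₂T] with t ht x
    have ht₁t : t₁ < t := lt_of_le_of_lt (le_max_left _ _) ht.1
    have hTt : 0 < T - t := sub_pos.2 ht.2
    have hsq : 0 < Real.sqrt (T - t) := Real.sqrt_pos.2 hTt
    have h1 := hbound t ⟨ht₁t, ht.2⟩ x
    have h2 : ‖u t x‖ ≤ K + 2 * δc * (Real.sqrt (T - t))⁻¹ := by
      have hnn : 0 ≤ (Real.sqrt (T - t₁))⁻¹ := inv_nonneg.2 (Real.sqrt_nonneg _)
      have : 2 * δc * ((Real.sqrt (T - t))⁻¹ - (Real.sqrt (T - t₁))⁻¹) ≤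
          2 * δc * (Real.sqrt (T - t))⁻¹ :=
        mul_le_mul_of_nonneg_left (by linarith) (by positivity)
      rw [hKdef]; linarith
    have h3 : Real.sqrt (T - t) * ‖u t x‖ ≤ K * Real.sqrt (T - t) + 2 * δc := by
      have := mul_le_mul_of_nonneg_left h2 hsq.le
      have e : Real.sqrt (T - t) * (K + 2 * δc * (Real.sqrt (T - t))⁻¹) =
          K * Real.sqrt (T - t) + 2 * δc := by
        field_simp
      linarith [e ▸ this]
    have h4 : Real.sqrt (T - t) ≤ g * Real.sqrt ν / (2 * K) := by
      have hTtρ : T - t ≤ ρ := by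
        have : T - ρ ≤ t := (le_max_right _ _).trans ht.1.le
        linarith
      have hnn : 0 ≤ g * Real.sqrt ν / (2 * K) := by positivity
      calc Real.sqrt (T - t) ≤ Real.sqrt ρ := Real.sqrt_le_sqrt hTtρ
        _ = g * Real.sqrt ν / (2 * K) := by rw [hρdef, Real.sqrt_sq hnn]
    have h5 : K * Real.sqrt (T - t) ≤ g * Real.sqrt ν / 2 := by
      have := mul_le_mul_of_nonneg_left h4 hK0.le
      have e : K * (g * Real.sqrt ν / (2 * K)) = g * Real.sqrt ν / 2 := by
        field_simp
      linarith [e ▸ this]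
    have h6 : 2 * δc = (2 * δ + g / 2) * Real.sqrt ν := by rw [hδcdef]; ring
    have h7 : C * Real.sqrt ν = (2 * δ + g) * Real.sqrt ν := by rw [hCdef, hgdef]; ring
    rw [h7]
    nlinarith [h3, h5, h6, hsν.le]
  exact hF1a ν T C hν hT hC0 hκC u p hsol hLH hdec hrate

/-- **Signed schema row P-obs EXCLUDED (kernel).** [folklore] -/
theorem rowPobs_holds : Row_Pobs := rowPobs_of_rowF1a ScenarioCensus.row_F1a_excluded

/-- P-obs ⊇ F-obs: the signed row implies the normed one (Cauchy–Schwarz). [folklore] -/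
theorem rowFobs_of_rowPobs (h : Row_Pobs) : Row_Fobs := by
  intro ν T δ hν hT hδ hδlt b u p hsol hLH hdec hchar hqs
  obtain ⟨Λ, hev⟩ := hqs
  refine h ν T δ hν hT hδ hδlt b u p hsol hLH hdec hchar ⟨Λ, ?_⟩
  filter_upwards [hev] with t ht x hΛ
  calc ⟪u t x, timeDerivWithin (Ico 0 T) u t x + convect (b t) (u t) x⟫
      ≤ ‖u t x‖ * ‖timeDerivWithin (Ico 0 T) u t x + convect (b t) (u t) x‖ := real_inner_le_norm _ _
    _ ≤ ‖u t x‖ * (δ * Real.sqrt ν / ((T - t) * Real.sqrt (T - t))) :=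
        mul_le_mul_of_nonneg_left (ht x hΛ) (norm_nonneg _)
    _ = δ * Real.sqrt ν / ((T - t) * Real.sqrt (T - t)) * ‖u t x‖ := mul_comm _ _

/-- **Row P-lab EXCLUDED (kernel)** (b ≡ 0). [folklore] -/
theorem rowPlab_holds : Row_Plab := by
  intro ν T δ hν hT hδ hδlt u p hsol hLH hdec hqs
  obtain ⟨Λ, hev⟩ := hqs
  refine rowPobs_holds ν T δ hν hT hδ hδlt (fun _ _ => 0) u p hsol hLH hdec
    (fun t₁ _ => hasCharacteristics_const 0 t₁ T) ⟨Λ, ?_⟩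
  filter_upwards [hev] with t ht x hΛ
  simpa [convect] using ht x hΛ

/-- **Row P-pow EXCLUDED (kernel)** (b = u through the momentum equation). [folklore] -/
theorem rowPpow_holds : Row_Ppow := by
  intro ν T δ hν hT hδ hδlt u p hsol hLH hdec hP
  obtain ⟨Λ, hev⟩ := hP
  refine rowPobs_holds ν T δ hν hT hδ hδlt u u p hsol hLH hdec
    (fun t₁ ht₁ => hasCharacteristics_velocity hν hT hsol hLH hdec ht₁) ⟨Λ, ?_⟩
  filter_upwards [hev, Ioo_mem_nhdsLT hT] with t ht ht' x hΛ
  have hmom := hsol.momentum t ⟨ht'.1.le, ht'.2⟩ x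
  simp only [Pi.zero_apply, add_zero] at hmom
  rw [hmom]
  exact ht x hΛ

/-- **THE GAIN FLOOR of every Clay blow-up** (structural theorem, kernel): no blow-up without
supercritical work on the fast fluid. [folklore] -/
theorem gainFloor_holds : GainFloor := by
  intro ν T hν hT u p hmax hLH hdec δ Λ t₁ hδ hδlt ht₁T
  by_contra hcon
  push Not at hcon
  have hP : ∃ Λ : ℝ, ∀ᶠ t in 𝓝[<] T, ∀ x, Λ < ‖u t x‖ →
      ⟪u t x, ν • Δ (u t) x - gradient (p t) x⟫ ≤
        δ * Real.sqrt ν / ((T - t) * Real.sqrt (T - t)) * ‖u t x‖ := by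
    refine ⟨Λ, ?_⟩
    filter_upwards [Ioo_mem_nhdsLT ht₁T] with t ht x hΛ using hcon t ht x hΛ
  exact hmax.2 (rowPpow_holds ν T δ hν hT hδ hδlt u p hmax.1 hLH hdec hP)

/-- The gain floor implies the force floor (Cauchy–Schwarz), recorded as a lattice edge. [folklore] -/
theorem forceFloor_of_gainFloor (h : GainFloor) : ForceFloor := by
  intro ν T hν hT u p hmax hLH hdec δ Λ t₁ hδ hδlt ht₁T
  obtain ⟨t, ht, x, hΛ, hlt⟩ := h ν T hν hT u p hmax hLH hdec δ Λ t₁ hδ hδlt ht₁T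
  refine ⟨t, ht, x, hΛ, ?_⟩
  have hcs := real_inner_le_norm (u t x) (ν • Δ (u t) x - gradient (p t) x)
  by_contra hle
  push Not at hle
  have : ⟪u t x, ν • Δ (u t) x - gradient (p t) x⟫ ≤
      δ * Real.sqrt ν / ((T - t) * Real.sqrt (T - t)) * ‖u t x‖ := by
    calc _ ≤ ‖u t x‖ * ‖ν • Δ (u t) x - gradient (p t) x‖ := hcs
      _ ≤ ‖u t x‖ * (δ * Real.sqrt ν / ((T - t) * Real.sqrt (T - t))) :=
          mul_le_mul_of_nonneg_left hle (norm_nonneg _)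
      _ = _ := mul_comm _ _
  exact absurd hlt (not_lt.2 this)

end Summit.NavierStokesRegularity.NavierStokesRegularity.Theorems.ScenarioCensus.ObserverTop

end
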